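import Literature.Computability.QuantumComplexity.IQPForrelation
import HarnessLib

/-!
# Item `CubicForrelation.SignedCubicForrelationInPrBPP` (stmt-QuantumAdvantage-13933) — M-defect toolkit, I

Support file for the r7 item of route `QuantumAdvantage/CubicForrelation` (line `polar-radical-seeds`, registered
skeleton `e0be2adf79ca`, whose open content is `stub_finderR` + `stub_residueR`, the latter discharged by the
structural conjecture `stub_structure`: one-sided logarithmic M-DEFECT for every in-promise cubic pair). This file and
its two sequels (`…DefectDirectSum.lean`, `…StructureNeedsDillon.lean`) prove that `stub_structure` PRESUPPOSES the
Dillon form of the classification item `ExactPairsMaioranaMcFarland`: under `stub_structure` every exact cubic pair has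
a half-dimensional M-subspace on both sides, because the maximal size of an M-subspace is sub-multiplicative under
direct sums while `Φ` is multiplicative.

Here: the finite symplectic lemma behind sub-multiplicativity, in the tree's `Finset (Fin m → Bool)` / `bxor`
vocabulary (no `Submodule (ZMod 2)`):
* `card_filter_ker_mul_two` — a non-trivial additive `Bool`-valued map on a `⊕`-closed finset has a kernel of index 2;
* `exists_isotropic_subgroup` — for a symmetric, alternating, right-additive `Bool`-valued form `c` on a `⊕`-closed
  `W ∋ 0` and any `R ⊆ W` orthogonal to `W`, some `⊕`-closed isotropic `W₀ ∋ 0` has `|W|·|R| ≤ |W₀|²`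
  (i.e. `dim W₀ ≥ (dim W + dim Rad)/2`; symplectic reduction by hyperbolic planes, MacWilliams–Sloane Ch. 15 §2);
* bookkeeping on second differences `Δ_u Δ_v F(y) = F y ⊕ F(y⊕u) ⊕ F(y⊕v) ⊕ F(y⊕u⊕v)` (`sd_bxor_right`, `sd_comm`,
  `sd_self`, `sd_zero_left`, `xor_quad_eq_of_xor_pairs`) and the fibre bound `card_le_card_image_mul_card_ker`.

References: F. J. MacWilliams, N. J. A. Sloane, The Theory of Error-Correcting Codes (1977), Ch. 15 §2 (symplectic
forms over GF(2)); C. Carlet, Boolean Functions for Cryptography and Coding Theory (CUP 2021), Prop. 54 (M-subspaces,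
Dillon's criterion for the completed Maiorana–McFarland class).
-/

noncomputable section

set_option linter.dupNamespace false -- D-0017: single-problem summit ⇒ `QuantumAdvantage.QuantumAdvantage` by design

namespace Summit.QuantumAdvantage.QuantumAdvantage.Theorems.SignedCubicForrelationInPrBPP.DirectSumDefect

open Finset
open Literature.Computability.QuantumComplexity
open Literature.Computability.QuantumComplexity.BuzetChailloux (bxor zeroVec bxor_comm bxor_self bxor_zeroVec
  zeroVec_bxor bxor_bxor_cancel_left)

variable {m : ℕ}

/-- `bxor` is associative. -/
theorem bxor_assoc (x y z : Fin m → Bool) : bxor (bxor x y) z = bxor x (bxor y z) := by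
  funext i; simp

/-- Index two: the kernel of a non-trivial additive `Bool`-valued map on a `⊕`-closed finset has exactly half
the elements. -/
theorem card_filter_ker_mul_two {W : Finset (Fin m → Bool)}
    (hadd : ∀ x ∈ W, ∀ y ∈ W, bxor x y ∈ W) (φ : (Fin m → Bool) → Bool)
    (hφ : ∀ x ∈ W, ∀ y ∈ W, φ (bxor x y) = (φ x ^^ φ y)) {w : Fin m → Bool} (hw : w ∈ W)
    (hφw : φ w = true) :
    (W.filter fun v => φ v = false).card * 2 = W.card := by
  have himg : (W.filter fun v => φ v = false).image (bxor w) = W.filter fun v => φ v = true := by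
    ext v
    simp only [mem_image, mem_filter]
    constructor
    · rintro ⟨x, ⟨hxW, hxφ⟩, rfl⟩
      exact ⟨hadd w hw x hxW, by rw [hφ w hw x hxW, hφw, hxφ]; rfl⟩
    · rintro ⟨hvW, hvφ⟩
      refine ⟨bxor w v, ⟨hadd w hw v hvW, ?_⟩, bxor_bxor_cancel_left w v⟩
      rw [hφ w hw v hvW, hφw, hvφ]; rfl
  have hinj : Set.InjOn (bxor w) ↑(W.filter fun v => φ v = false) := by
    intro x _ y _ hxy
    have := congrArg (bxor w) hxy
    rwa [bxor_bxor_cancel_left, bxor_bxor_cancel_left] at this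
  have hcard : (W.filter fun v => φ v = true).card = (W.filter fun v => φ v = false).card := by
    rw [← himg, card_image_of_injOn hinj]
  have hsplit := card_filter_add_card_filter_not (s := W) (fun v => φ v = false)
  have hneg : (W.filter fun v => ¬ φ v = false) = W.filter fun v => φ v = true := by
    ext v; simp
  rw [hneg, hcard] at hsplit
  omega

/-- **Isotropic subgroups of an alternating form are large.** Let `W ∋ 0` be a `⊕`-closed finset of bit
vectors and `c` a `Bool`-valued form on `W` that is symmetric, alternating (`c u u = 0`) and additive in its
second argument. If `R ⊆ W` is orthogonal to all of `W`, then some `⊕`-closed `W₀ ∋ 0` inside `W` on which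
`c` vanishes identically has `|W| · |R| ≤ |W₀|²`. (Symplectic reduction: split off hyperbolic planes.) -/
theorem exists_isotropic_subgroup :
    ∀ (N : ℕ) (W : Finset (Fin m → Bool)), W.card ≤ N → zeroVec ∈ W →
      (∀ x ∈ W, ∀ y ∈ W, bxor x y ∈ W) →
      ∀ (c : (Fin m → Bool) → (Fin m → Bool) → Bool),
      (∀ u ∈ W, ∀ v ∈ W, c u v = c v u) → (∀ u ∈ W, c u u = false) →
      (∀ u ∈ W, ∀ v ∈ W, ∀ v' ∈ W, c u (bxor v v') = (c u v ^^ c u v')) →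
      ∀ (R : Finset (Fin m → Bool)), R ⊆ W → (∀ r ∈ R, ∀ w ∈ W, c r w = false) →
      ∃ W₀ : Finset (Fin m → Bool), W₀ ⊆ W ∧ zeroVec ∈ W₀ ∧ (∀ x ∈ W₀, ∀ y ∈ W₀, bxor x y ∈ W₀) ∧
        (∀ u ∈ W₀, ∀ v ∈ W₀, c u v = false) ∧ W.card * R.card ≤ W₀.card ^ 2 := by
  intro N
  induction N with
  | zero =>
    intro W hW h0
    exact absurd (card_pos.2 ⟨_, h0⟩) (by omega)
  | succ N ih =>
    intro W hWN h0 hadd c hsymm halt haddr R hRW hR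
    by_cases hiso : ∀ u ∈ W, ∀ v ∈ W, c u v = false
    · refine ⟨W, Subset.rfl, h0, hadd, hiso, ?_⟩
      rw [sq]
      exact Nat.mul_le_mul_left _ (card_le_card hRW)
    push Not at hiso
    obtain ⟨u, hu, w, hw, huw⟩ := hiso
    replace huw : c u w = true := by simpa using huw
    -- the double orthogonal complement `W' = u^⊥ ∩ w^⊥` has index 4
    set W'' : Finset (Fin m → Bool) := W.filter fun v => c u v = false with hW''
    set W' : Finset (Fin m → Bool) := W''.filter fun v => c w v = false with hW'
    have hW''W : W'' ⊆ W := filter_subset _ _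
    have hW'W'' : W' ⊆ W'' := filter_subset _ _
    have hW'W : W' ⊆ W := hW'W''.trans hW''W
    have hc0 : ∀ x ∈ W, c x zeroVec = false := by
      intro x hx
      have := haddr x hx zeroVec h0 zeroVec h0
      rw [bxor_self] at this
      revert this; cases c x zeroVec <;> simp
    have h0'' : zeroVec ∈ W'' := mem_filter.2 ⟨h0, hc0 u hu⟩
    have hadd'' : ∀ x ∈ W'', ∀ y ∈ W'', bxor x y ∈ W'' := by
      intro x hx y hy
      obtain ⟨hxW, hxu⟩ := mem_filter.1 hx
      obtain ⟨hyW, hyu⟩ := mem_filter.1 hy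
      exact mem_filter.2 ⟨hadd x hxW y hyW, by rw [haddr u hu x hxW y hyW, hxu, hyu]; rfl⟩
    have h0' : zeroVec ∈ W' := mem_filter.2 ⟨h0'', hc0 w hw⟩
    have hadd' : ∀ x ∈ W', ∀ y ∈ W', bxor x y ∈ W' := by
      intro x hx y hy
      obtain ⟨hxW, hxw⟩ := mem_filter.1 hx
      obtain ⟨hyW, hyw⟩ := mem_filter.1 hy
      exact mem_filter.2 ⟨hadd'' x hxW y hyW,
        by rw [haddr w hw x (hW''W hxW) y (hW''W hyW), hxw, hyw]; rfl⟩
    have hidx'' : W''.card * 2 = W.card :=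
      card_filter_ker_mul_two hadd (c u) (fun x hx y hy => haddr u hu x hx y hy) hw huw
    have huW'' : u ∈ W'' := mem_filter.2 ⟨hu, halt u hu⟩
    have hidx' : W'.card * 2 = W''.card :=
      card_filter_ker_mul_two hadd'' (c w) (fun x hx y hy => haddr w hw x (hW''W hx) y (hW''W hy)) huW''
        (by rw [hsymm w hw u hu, huw])
    have hidx : W'.card * 4 = W.card := by rw [← hidx'', ← hidx']; ring
    have hWpos : 0 < W.card := card_pos.2 ⟨_, h0⟩
    have hW'N : W'.card ≤ N := by omega
    -- the radical vectors stay inside `W'`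
    have hRW' : R ⊆ W' := by
      intro r hr
      refine mem_filter.2 ⟨mem_filter.2 ⟨hRW hr, ?_⟩, ?_⟩
      · rw [hsymm u hu r (hRW hr)]; exact hR r hr u hu
      · rw [hsymm w hw r (hRW hr)]; exact hR r hr w hw
    obtain ⟨W₀', hW₀'W', h0₀, hadd₀, hiso₀, hcard₀⟩ := ih W' hW'N h0' hadd' c
      (fun x hx y hy => hsymm x (hW'W hx) y (hW'W hy)) (fun x hx => halt x (hW'W hx))
      (fun x hx y hy y' hy' => haddr x (hW'W hx) y (hW'W hy) y' (hW'W hy')) R hRW'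
      (fun r hr x hx => hR r hr x (hW'W hx))
    -- adjoin `u`: `W₀ = W₀' ∪ (u ⊕ W₀')`
    have huW : ∀ a ∈ W₀', bxor u a ∈ W := fun a ha => hadd u hu a (hW'W (hW₀'W' ha))
    have hcu : ∀ a ∈ W₀', c u a = false := fun a ha => (mem_filter.1 (hW'W'' (hW₀'W' ha))).2
    have hnot : ∀ a ∈ W₀', ∀ b ∈ W₀', bxor u a ≠ b := by
      intro a ha b hb hab
      have hu' : u = bxor b a := by
        have := congrArg (fun z => bxor z a) hab
        simp only [bxor_assoc, bxor_self, bxor_zeroVec] at this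
        exact this
      have huW' : u ∈ W' := by rw [hu']; exact hadd' b (hW₀'W' hb) a (hW₀'W' ha)
      have := (mem_filter.1 huW').2
      rw [hsymm w hw u hu, huw] at this
      exact Bool.noConfusion this
    refine ⟨W₀' ∪ W₀'.image (bxor u), ?_, ?_, ?_, ?_, ?_⟩
    · intro x hx
      rcases mem_union.1 hx with hx | hx
      · exact hW'W (hW₀'W' hx)
      · obtain ⟨a, ha, rfl⟩ := mem_image.1 hx
        exact huW a ha
    · exact mem_union.2 (Or.inl h0₀)
    · intro x hx y hy
      rcases mem_union.1 hx with hx | hx <;> rcases mem_union.1 hy with hy | hy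
      · exact mem_union.2 (Or.inl (hadd₀ x hx y hy))
      · obtain ⟨b, hb, rfl⟩ := mem_image.1 hy
        refine mem_union.2 (Or.inr (mem_image.2 ⟨bxor x b, hadd₀ x hx b hb, ?_⟩))
        rw [← bxor_assoc, bxor_comm u x, bxor_assoc]
      · obtain ⟨a, ha, rfl⟩ := mem_image.1 hx
        refine mem_union.2 (Or.inr (mem_image.2 ⟨bxor a y, hadd₀ a ha y hy, ?_⟩))
        rw [bxor_assoc]
      · obtain ⟨a, ha, rfl⟩ := mem_image.1 hx
        obtain ⟨b, hb, rfl⟩ := mem_image.1 hy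
        refine mem_union.2 (Or.inl ?_)
        have : bxor (bxor u a) (bxor u b) = bxor a b := by
          rw [bxor_assoc, ← bxor_assoc a u b, bxor_comm a u, bxor_assoc, ← bxor_assoc u u,
            bxor_self, zeroVec_bxor]
        rw [this]; exact hadd₀ a ha b hb
    · intro x hx y hy
      have hW₀W : ∀ a ∈ W₀', a ∈ W := fun a ha => hW'W (hW₀'W' ha)
      rcases mem_union.1 hx with hx | hx <;> rcases mem_union.1 hy with hy | hy
      · exact hiso₀ x hx y hy
      · obtain ⟨b, hb, rfl⟩ := mem_image.1 hy
        rw [haddr x (hW₀W x hx) u hu b (hW₀W b hb), hiso₀ x hx b hb, hsymm x (hW₀W x hx) u hu,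
          hcu x hx]; rfl
      · obtain ⟨a, ha, rfl⟩ := mem_image.1 hx
        rw [hsymm _ (huW a ha) y (hW₀W y hy), haddr y (hW₀W y hy) u hu a (hW₀W a ha), hiso₀ y hy a ha,
          hsymm y (hW₀W y hy) u hu, hcu y hy]; rfl
      · obtain ⟨a, ha, rfl⟩ := mem_image.1 hx
        obtain ⟨b, hb, rfl⟩ := mem_image.1 hy
        rw [haddr _ (huW a ha) u hu b (hW₀W b hb), hsymm _ (huW a ha) u hu, hsymm _ (huW a ha) b (hW₀W b hb),
          haddr u hu u hu a (hW₀W a ha), haddr b (hW₀W b hb) u hu a (hW₀W a ha), halt u hu, hcu a ha,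
          hsymm b (hW₀W b hb) u hu, hcu b hb, hiso₀ b hb a ha]; rfl
    · have hdisj : Disjoint W₀' (W₀'.image (bxor u)) := by
        rw [disjoint_left]
        intro b hb hb'
        obtain ⟨a, ha, hab⟩ := mem_image.1 hb'
        exact hnot a ha b hb hab
      have hinj : Set.InjOn (bxor u) ↑W₀' := by
        intro x _ y _ hxy
        have := congrArg (bxor u) hxy
        rwa [bxor_bxor_cancel_left, bxor_bxor_cancel_left] at this
      rw [card_union_of_disjoint hdisj, card_image_of_injOn hinj, ← hidx]
      nlinarith [hcard₀]


/-! ### Second-difference bookkeeping and a fibre bound (used by `…DefectDirectSum.lean`) -/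

/-- Eight-variable `xor` bookkeeping: if the xor of four `aᵢ ⊕ bᵢ` vanishes then the xor of the `aᵢ` equals the
xor of the `bᵢ`. -/
theorem xor_quad_eq_of_xor_pairs (a₁ a₂ a₃ a₄ b₁ b₂ b₃ b₄ : Bool)
    (h : ((a₁ ^^ b₁) ^^ (a₂ ^^ b₂) ^^ (a₃ ^^ b₃) ^^ (a₄ ^^ b₄)) = false) :
    (a₁ ^^ a₂ ^^ a₃ ^^ a₄) = (b₁ ^^ b₂ ^^ b₃ ^^ b₄) := by
  revert h a₁ a₂ a₃ a₄ b₁ b₂ b₃ b₄; decide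

/-- Second differences compose: `Δ_a Δ_{b ⊕ b'} F (y) = Δ_a Δ_b F (y) ⊕ Δ_a Δ_{b'} F (y ⊕ b)`. -/
theorem sd_bxor_right {m : ℕ} (F : (Fin m → Bool) → Bool) (y a b b' : Fin m → Bool) :
    (F y ^^ F (bxor y a) ^^ F (bxor y (bxor b b')) ^^ F (bxor y (bxor a (bxor b b')))) =
      ((F y ^^ F (bxor y a) ^^ F (bxor y b) ^^ F (bxor y (bxor a b))) ^^
        (F (bxor y b) ^^ F (bxor (bxor y b) a) ^^ F (bxor (bxor y b) b') ^^
          F (bxor (bxor y b) (bxor a b')))) := by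
  have e1 : bxor (bxor y b) a = bxor y (bxor a b) := by
    rw [bxor_assoc, bxor_comm b a]
  have e2 : bxor (bxor y b) b' = bxor y (bxor b b') := bxor_assoc y b b'
  have e3 : bxor (bxor y b) (bxor a b') = bxor y (bxor a (bxor b b')) := by
    rw [bxor_assoc, ← bxor_assoc b a b', bxor_comm b a, bxor_assoc]
  rw [e1, e2, e3]
  generalize F y = p; generalize F (bxor y a) = q; generalize F (bxor y (bxor b b')) = r
  generalize F (bxor y (bxor a (bxor b b'))) = s; generalize F (bxor y b) = t
  generalize F (bxor y (bxor a b)) = w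
  revert p q r s t w; decide

/-- Second differences are symmetric in the two directions. -/
theorem sd_comm {m : ℕ} (F : (Fin m → Bool) → Bool) (y a b : Fin m → Bool) :
    (F y ^^ F (bxor y a) ^^ F (bxor y b) ^^ F (bxor y (bxor a b))) =
      (F y ^^ F (bxor y b) ^^ F (bxor y a) ^^ F (bxor y (bxor b a))) := by
  rw [bxor_comm b a]
  generalize F y = p; generalize F (bxor y a) = q; generalize F (bxor y b) = r
  generalize F (bxor y (bxor a b)) = s
  revert p q r s; decide

/-- Second differences vanish on the diagonal direction pair. -/
theorem sd_self {m : ℕ} (F : (Fin m → Bool) → Bool) (y a : Fin m → Bool) :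
    (F y ^^ F (bxor y a) ^^ F (bxor y a) ^^ F (bxor y (bxor a a))) = false := by
  rw [bxor_self, bxor_zeroVec]
  generalize F y = p; generalize F (bxor y a) = q
  revert p q; decide

/-- Second differences with a zero direction vanish. -/
theorem sd_zero_left {m : ℕ} (F : (Fin m → Bool) → Bool) (y b : Fin m → Bool) :
    (F y ^^ F (bxor y zeroVec) ^^ F (bxor y b) ^^ F (bxor y (bxor zeroVec b))) = false := by
  rw [bxor_zeroVec, zeroVec_bxor]
  generalize F y = p; generalize F (bxor y b) = q
  revert p q; decide

/-- Fibre bound: a `⊕`-closed finset is at most (image) × (kernel) large under an additive map. -/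
theorem card_le_card_image_mul_card_ker {m m' : ℕ} {W : Finset (Fin m → Bool)}
    (hadd : ∀ x ∈ W, ∀ y ∈ W, bxor x y ∈ W) (p : (Fin m → Bool) → (Fin m' → Bool))
    (hp : ∀ x y, p (bxor x y) = bxor (p x) (p y)) :
    W.card ≤ (W.image p).card * (W.filter fun x => p x = zeroVec).card := by
  rw [mul_comm]
  refine card_le_mul_card_image W _ fun a ha => ?_
  obtain ⟨u₀, hu₀, rfl⟩ := mem_image.1 ha
  refine card_le_card_of_injOn (bxor u₀) (fun u hu => ?_) ?_
  · obtain ⟨huW, hpu⟩ := mem_filter.1 hu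
    refine mem_filter.2 ⟨hadd u₀ hu₀ u huW, ?_⟩
    rw [hp, hpu, bxor_self]
  · intro x _ y _ hxy
    have := congrArg (bxor u₀) hxy
    rwa [bxor_bxor_cancel_left, bxor_bxor_cancel_left] at this

end Summit.QuantumAdvantage.QuantumAdvantage.Theorems.SignedCubicForrelationInPrBPP.DirectSumDefect

end
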